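import Summits.QuantumFields.QCD.Theorems.WilsonMobilityGapMobilityGapSketchFreeDefs

/-!
# Crux `MobilityGap` (stmt-QuantumFields-9150) — line `Sketch` with FREE DATA: the kernel-checked reduction

`MobilityGap ⇐ LawLightFree ∧ LawLowerFree ∧ LawExtinctFree` (`MobilityGap_of_freeLaws`, registered on the
crux), over `…SketchFreeDefs.lean`; and conversely `MobilityGap ⇒ LawLightFree`
(`lawLightFree_of_mobilityGap`): the infrared stub of the reshaped line is NECESSARY.  §A anchor along any datum
(the floor `1/10` is good eventually, from the landed hopping bound) · §B light glue (`LightMomentAt d ⇒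
BadFloorAt d`) · §C sign glue (`ExtinctAt d ⇒ SignAt d`, Markov on the landed `PositivityDeficitLeDefects` via the
data-free `sign_of_extinct`) · §D composition along a datum · §E the deciding reductions.
-/

noncomputable section

namespace Summit.QuantumFields.QCD.Theorems.MobilityGapSketch

open scoped BigOperators Topology
open MeasureTheory Filter Set
open Literature.MathematicalPhysics.QuantumFieldTheory Literature.MathematicalPhysics.QuantumLattice
  Literature.Probability.LatticeModels
open Summit.QuantumFields.QCD.Theorems.MobilityGapNegative (norm_single_natCast)

variable {Nf : ℕ}

/-! ### §A The anchor along a datum: the floor `1/10` is good eventually, for every large rate `δ` -/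

/-- **HEAVY-MASS ANCHOR along `d`** (landed hopping bound `ThickCollarFarStability.stub_hopping` at exponent
`d.s`): for `δ ≥ max C 1`, eventually in `k` (as soon as `δ a_k ≤ μ d.s`), the floor `1/10` is good. -/
theorem anchorD (d : LineData Nf) :
    ∀ᶠ δ in atTop, ∀ᶠ k in atTop, (1 / 10 : ℝ) ∈ floorSetD d δ k := by
  obtain ⟨C, μ, -, hμ, hhop⟩ :=
    Summit.QuantumFields.QCD.Theorems.ThickCollarFarStability.stub_hopping Nf
  filter_upwards [eventually_ge_atTop (max C 1)] with δ hδ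
  have hδ1 : 1 ≤ δ := (le_max_right C 1).trans hδ
  have hδpos : 0 < δ := one_pos.trans_le hδ1
  have hCδ : C ≤ Real.exp δ :=
    ((le_max_left C 1).trans hδ).trans (by have := Real.add_one_le_exp δ; linarith)
  have hμδ : 0 < μ * d.s / δ := div_pos (mul_pos hμ d.s_pos) hδpos
  filter_upwards [d.tendsto_a.eventually (eventually_le_nhds hμδ)] with k hk
  have hak : δ * d.a k ≤ μ * d.s := by
    have := mul_le_mul_of_nonneg_left hk hδpos.le
    calc δ * d.a k ≤ δ * (μ * d.s / δ) := this
      _ = μ * d.s := by field_simp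
  refine ⟨by norm_num, fun t ht _ S _ f v hv => ?_⟩
  have h41 : (41 / 10 : ℝ) ≤ |t f + 4| := by
    have := ht f
    rw [abs_of_nonneg (by linarith)]
    linarith
  have hb := hhop (d.β k) t f h41 S d.s d.s_pos d.s_lt_one v hv
  have hv0 : 0 ≤ ‖v‖ := norm_nonneg _
  calc fm Nf (d.β k) t S f v d.s ≤ C * Real.exp (-(μ * d.s * ‖v‖)) := hb
    _ ≤ Real.exp δ * Real.exp (-(δ * (d.a k * ‖v‖))) := by
        apply mul_le_mul hCδ _ (Real.exp_pos _).le (Real.exp_pos _).le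
        apply Real.exp_le_exp.2
        have : δ * (d.a k * ‖v‖) = (δ * d.a k) * ‖v‖ := by ring
        rw [this]
        nlinarith

/-- The floor set along `d` is non-empty eventually (for every large `δ`). -/
theorem floorSetD_nonempty (d : LineData Nf) :
    ∀ᶠ δ in atTop, ∀ᶠ k in atTop, (floorSetD d δ k).Nonempty :=
  (anchorD d).mono fun _ hδ => hδ.mono fun _ hk => ⟨_, hk⟩

/-- `m_crit(k) ≤ 1/10` eventually along `d`. -/
theorem thrD_le_tenth (d : LineData Nf) :
    ∀ᶠ δ in atTop, ∀ᶠ k in atTop, thrD d δ k ≤ 1 / 10 :=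
  (anchorD d).mono fun _ hδ => hδ.mono fun _ hk => thrD_le_of_mem hk

/-! ### §B Light glue along a datum -/

/-- **A light `d.s`-moment along `(d.a, d.β)` yields a bad floor above `-1` for every `δ > r`**: at distance
`n > (δ - log c)/((δ - r) a_k)` along `e₀` on the torus of side `2 max(S₀, L⁰_k, n) + 1` the lower bound
`c e^{-r a_k n}` beats the certificate `e^{δ} e^{-δ a_k n}` of the degenerate tuple `x`. -/
theorem badFloorAt_of_lightMomentAt {d : LineData Nf} (h : LightMomentAt Nf d.a d.β d.s) : BadFloorAt d := by
  obtain ⟨r, hk⟩ := h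
  filter_upwards [eventually_gt_atTop r] with δ hδ
  filter_upwards [hk] with k hkk
  obtain ⟨x, hx, f, c, hc, S₀, hS⟩ := hkk
  refine ⟨x, hx, fun hgood => ?_⟩
  have hD : 0 < (δ - r) * d.a k := mul_pos (by linarith) (d.a_pos k)
  obtain ⟨n, hn⟩ := exists_nat_gt ((δ - Real.log c) / ((δ - r) * d.a k))
  have hn' : δ - Real.log c < (δ - r) * d.a k * n := by
    rwa [div_lt_iff₀ hD, mul_comm] at hn
  set S : ℕ := max (max S₀ (d.vfloor k)) n with hSdef
  have hS₀ : S₀ ≤ S := (le_max_left _ _).trans (le_max_left _ _)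
  have hLS : d.vfloor k ≤ S := (le_max_right _ _).trans (le_max_left _ _)
  have hnS : n ≤ S := le_max_right _ _
  have hcert : CertifiedD d δ k (fun _ => x) :=
    hgood _ (fun _ => le_rfl) (fun _ _ => by simpa using d.slab_nonneg k)
  have hup := hcert S hLS f (Pi.single 0 (n : ℤ)) (single_mem_box_of_le hnS)
  rw [norm_single_natCast] at hup
  have hlow := hS S hS₀ n hnS
  have hlt : Real.exp δ * Real.exp (-(δ * (d.a k * n))) < c * Real.exp (-(r * (d.a k * n))) := by
    rw [← Real.exp_log hc, ← Real.exp_add, ← Real.exp_add, Real.exp_lt_exp]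
    nlinarith [hn']
  exact (lt_irrefl _) ((hlow.trans hup).trans_lt hlt)

/-! ### §C Sign glue along a datum -/

/-- `ExtinctAt d → SignAt d` (the data-free `sign_of_extinct`: Markov on the landed positivity-deficit bound). -/
theorem signAt_of_extinctAt {d : LineData Nf} (h : ExtinctAt d) : SignAt d := by
  obtain ⟨L, hL, hfl, hδ⟩ := h
  refine ⟨L, hL, hfl, hδ.mono fun δ hd M hM => (hd M hM).mono fun k hk hne hthr t ht₁ ht₂ => ?_⟩
  exact sign_of_extinct (d.β k) t (hk hne hthr t ht₁ ht₂)

/-! ### §D The composition along a datum -/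

/-- **Composition along `d`**: a bad floor above `-1`, the lower law and the sign law along ONE admissible datum
give a witness of the crux's clause package — `reg := thrRegD d L δ` with `L` from the sign law and `δ` in the
intersection of the four `δ`-filters; both scalings hold by construction of the data; (i) from `-1 ≤ m_crit`;
(ii) at `(s, δ, C) := (d.s, δ, e^{δ})` BY DEFINITION of the threshold (the realised tuple lies strictly above the
infimum with spread `≤ w_k` eventually, hence is certified); (iii) from the bad floor (`-1 < m_crit`) and the lower
law at `M := Σ_f m_f + 1`; (iv) from the sign law. -/
theorem compositionD (d : LineData Nf) (h₁ : BadFloorAt d) (h₂ : LowerAt d) (h₃ : SignAt d) :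
    ∃ reg : QCDRegularisation Nf, Clauses Nf reg := by
  obtain ⟨L, hL, hfl, hSGδ⟩ := h₃
  obtain ⟨δ, hδ, hne, hLP, hLW, hSG⟩ :=
    ((eventually_gt_atTop (0 : ℝ)).and ((floorSetD_nonempty d).and (h₁.and (h₂.and hSGδ)))).exists
  have hthr : ∀ᶠ k in atTop, -1 < thrD d δ k := by
    filter_upwards [hne, hLP] with k hk ⟨x, hx, hxg⟩
    exact hx.trans_le (le_thrD_of_not_isGoodFloorD hk hxg)
  refine ⟨thrRegD d L hL δ, thrRegD_hasMassScaling d L hL δ, thrRegD_hasAsymptoticScaling d L hL δ,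
    fun m hm => ?_⟩
  set M : ℝ := (∑ f, m f) + 1 with hMdef
  have hMpos : 0 < M := by
    have : 0 ≤ ∑ f, m f := Finset.sum_nonneg fun f _ => (hm f).le
    linarith
  have hmM : ∀ f, m f ≤ M := fun f =>
    (Finset.single_le_sum (fun g _ => (hm g).le) (Finset.mem_univ f)).trans (le_add_of_nonneg_right zero_le_one)
  have hwin₁ : ∀ k f, thrD d δ k < thrD d δ k + d.a k * m f / d.zm k := fun k f =>
    lt_add_of_pos_right _ (div_pos (mul_pos (d.a_pos k) (hm f)) (d.zm_pos k))
  have hwin₂ : ∀ k f, thrD d δ k + d.a k * m f / d.zm k ≤ thrD d δ k + d.a k * M / d.zm k := fun k f => by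
    have := div_le_div_of_nonneg_right (mul_le_mul_of_nonneg_left (hmM f) (d.a_pos k).le) (d.zm_pos k).le
    linarith
  have hB : ∀ f g, |m f - m g| ≤ M := fun f g => by
    rw [abs_sub_le_iff]
    constructor <;> linarith [hmM f, hmM g, hm f, hm g]
  have hspread : ∀ᶠ k in atTop, ∀ f g,
      |(thrD d δ k + d.a k * m f / d.zm k) - (thrD d δ k + d.a k * m g / d.zm k)| ≤ d.slab k := by
    filter_upwards [d.tendsto_ell.eventually_ge_atTop M] with k hk f g
    have hq : 0 < d.a k / d.zm k := div_pos (d.a_pos k) (d.zm_pos k)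
    have : (thrD d δ k + d.a k * m f / d.zm k) - (thrD d δ k + d.a k * m g / d.zm k)
        = d.a k / d.zm k * (m f - m g) := by ring
    rw [this, abs_mul, abs_of_pos hq]
    calc d.a k / d.zm k * |m f - m g| ≤ d.a k / d.zm k * d.ell k :=
          mul_le_mul_of_nonneg_left ((hB f g).trans hk) hq.le
      _ = d.slab k := by unfold LineData.slab; ring
  have hcert : ∀ᶠ k in atTop, CertifiedD d δ k (fun fl => thrD d δ k + d.a k * m fl / d.zm k) := by
    filter_upwards [hne, hspread] with k hk hsp
    exact certifiedD_of_thrD_lt hk (fun f => hwin₁ k f) hsp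
  refine ⟨?_, ?_, ?_, ?_⟩
  · -- clause (i)
    intro f
    filter_upwards [hne] with k hk
    show -1 < thrD d δ k + d.a k * m f / d.zm k
    have h1 := neg_one_le_thrD hk
    have h2 : 0 < d.a k * m f / d.zm k := div_pos (mul_pos (d.a_pos k) (hm f)) (d.zm_pos k)
    linarith
  · -- clause (ii): BY DEFINITION of the threshold, at the datum's exponent
    refine ⟨d.s, δ, Real.exp δ, d.s_pos, d.s_lt_one, hδ, ?_⟩
    filter_upwards [hcert, hfl] with k hck hflk S hS f v hv
    exact hck S (hflk.trans hS) f v hv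
  · -- clause (iii)
    obtain ⟨s, c₀, C₁, p, hs, hs1, hc₀, hT⟩ := hLW M hMpos
    refine ⟨s, c₀, C₁, p, hs, hs1, hc₀, ?_⟩
    filter_upwards [hne, hthr, hT, hfl] with k hk₀ hk hTk hflk S hS f n hn
    exact hTk hk₀ hk _ (fun f => hwin₁ k f) (fun f => hwin₂ k f) S (hflk.trans hS) f n hn
  · -- clause (iv)
    filter_upwards [hne, hthr, hSG M hMpos] with k hk₀ hk hSk
    exact hSk hk₀ hk _ (fun f => hwin₁ k f) (fun f => hwin₂ k f)

/-! ### §E The deciding reductions -/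

/-- **The crux from the three FREE laws** (registered on stmt-QuantumFields-9150 with the reshaped skeleton):
`LawLightFree → LawLowerFree → LawExtinctFree → MobilityGap` — pack the datum of the free light moment, run the
threshold line along it. -/
theorem MobilityGap_of_freeLaws :
    LawLightFree → LawLowerFree → LawExtinctFree →
      Summit.QuantumFields.QCD.Theses.WilsonMobilityGap.MobilityGap := by
  intro h₁ h₂ h₃ Nf hNf
  obtain ⟨d, hd⟩ := exists_lineData_of_lightMomentFree (h₁ Nf hNf)
  exact compositionD d (badFloorAt_of_lightMomentAt hd) (h₂ Nf hNf d hd) (signAt_of_extinctAt (h₃ Nf hNf d hd))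

/-- **The infrared law of the reshaped line is NECESSARY for the crux**: `MobilityGap → LawLightFree`
(clauses (i)+(iii) of any witness at the degenerate tuple `m ≡ 1`; landed `lightMomentFree_of_mobilityGap`). -/
theorem lawLightFree_of_mobilityGap (h : Summit.QuantumFields.QCD.Theses.WilsonMobilityGap.MobilityGap) :
    LawLightFree :=
  lightMomentFree_of_mobilityGap h

/-- The infrared law of the reshaped line follows from the sibling crux `PauliWegnerSea.OneScaleTrajectory`
(stmt-QuantumFields-11513). -/
theorem lawLightFree_of_oneScaleTrajectory
    (h : Summit.QuantumFields.QCD.Theses.PauliWegnerSea.OneScaleTrajectory) : LawLightFree :=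
  lightMomentFree_of_oneScaleTrajectory h

/-- The infrared law of the reshaped line follows from the pinned one (`LawLightMoment`, stub `stub_lightMoment` of
the pinned skeleton). -/
theorem lawLightFree_of_lawLightMoment (h : LawLightMoment) : LawLightFree :=
  lightMomentFree_of_lawLightMoment h

/-- The free line dominates the pinned one: with the two free laws, the PINNED infrared stub `LawLightMoment`
(skeleton v3) also closes the crux. -/
theorem MobilityGap_of_lawLightMoment_free (h₁ : LawLightMoment) (h₂ : LawLowerFree) (h₃ : LawExtinctFree) :
    Summit.QuantumFields.QCD.Theses.WilsonMobilityGap.MobilityGap :=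
  MobilityGap_of_freeLaws (lawLightFree_of_lawLightMoment h₁) h₂ h₃

/-- Hence the crux is EQUIVALENT to the conjunction of its infrared content with the two trajectory-universal laws
restricted to light data: `MobilityGap ↔ LawLightFree` given `LawLowerFree ∧ LawExtinctFree`. -/
theorem mobilityGap_iff_lawLightFree (h₂ : LawLowerFree) (h₃ : LawExtinctFree) :
    Summit.QuantumFields.QCD.Theses.WilsonMobilityGap.MobilityGap ↔ LawLightFree :=
  ⟨lawLightFree_of_mobilityGap, fun h₁ => MobilityGap_of_freeLaws h₁ h₂ h₃⟩

end Summit.QuantumFields.QCD.Theorems.MobilityGapSketch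

end
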